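import Summits.AtomisticToContinuum.HydrodynamicLimit.Theorems.RelayRaceLocalityNearConstantShortTimeHLEndgame
import Summits.AtomisticToContinuum.HydrodynamicLimit.Theorems.RelayRaceLocalityNearConstantShortTimeHLReduction4
import Summits.AtomisticToContinuum.HydrodynamicLimit.Theorems.RelayRaceLocalityNearConstantShortTimeHLDynamic4
import Summits.AtomisticToContinuum.HydrodynamicLimit.Theorems.RelayRaceLocalityNearConstantShortTimeHLDensityLDOfBallTilt
import HarnessLib

/-!
# Crux `NearConstantShortTimeHL` (stmt-AtomisticToContinuum-12502), line `small-tilt-domination`, skeleton v14 (lead c7):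
# the ENDGAME under the fourth-moment cap

Support file (`--supports stmt-AtomisticToContinuum-12502`). Composition of the landed pieces of skeleton v14: level 0
`reduction4` (p138206) ∘ level 1 `dynamic_theorem4` (p138985) through the means-pin dock and the entropy-to-LLN step give THE CRUX
from its open inputs in the corrected currency — the equilibrium closure K-stubs WITH the fourth-moment cap in the conditioning event
(`MomentumClosureTightness4`, `EnergyClosureTightness4`; the uniform-rate stubs without the cap are physics-level false, see
`Cruxes/NearConstantShortTimeHL/Lines/small-tilt-domination-S2S3-stub-false.md`), the a-priori caps along the true law
(`TrueLawCapsG` and the fourth-moment cap `FourthMomentCapPreShock`), and the statics input (St2′ `MesoscaleSuperlinearityE`, or its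
density core `MesoscaleDensityLD` through the landed position/velocity split).
References: H.-T. Yau, Lett. Math. Phys. 22 (1991) §2.
-/

noncomputable section

namespace Summit.AtomisticToContinuum.HydrodynamicLimit.Theorems.NearConstantShortTimeHL

open Summit.AtomisticToContinuum.HydrodynamicLimit.Theses.RelayRaceLocality (NearConstantShortTimeHL)

/-- **THE CRUX FROM ITS FIVE INPUTS UNDER THE FOURTH-MOMENT CAP** (registered endgame of skeleton v14): the mesoscale static
superlinearity St2′, the equilibrium momentum / energy closure tightness at a uniform rate under the fourth-moment cap (S2″, S3″),
the a-priori caps with Gaussian velocity tails along the true law (S4′) and the fourth-moment cap along the true law (S4d).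
[cite: Yau1991, §2] -/
theorem nearConstantShortTimeHL_of_inputs4 : MesoscaleSuperlinearityE → MomentumClosureTightness4 → EnergyClosureTightness4 → TrueLawCapsG → FourthMomentCapPreShock → NearConstantShortTimeHL :=
  fun hSt2 hS2 hS3 hS4 hS4d =>
    stub_entropyToLLN (stub_meansToRelEntropy (meansConverge_of_nearConstantRelEntropy
      (stub_meansPin stub_ldaGeneralFamilies stub_concentrationGeneralFamilies
        (reduction4 dynamic_theorem4 hSt2 stub_uniformPressure stub_staticLLN stub_smallTiltDomination hS2 hS3 hS4 hS4d))))

/-- **THE CRUX FROM THE DENSITY LARGE DEVIATION AND THE FOUR EQUILIBRIUM / A-PRIORI INPUTS** (skeleton v14): the velocity side of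
St2′ is closed (`stub_velocityLD stub_ballGaussianEstimate`), the position side is packing + bias over `MesoscaleDensityLD`.
[cite: Yau1991, §2] -/
theorem nearConstantShortTimeHL_of_densityLD4 : MesoscaleDensityLD → MomentumClosureTightness4 → EnergyClosureTightness4 → TrueLawCapsG → FourthMomentCapPreShock → NearConstantShortTimeHL :=
  fun hD => nearConstantShortTimeHL_of_inputs4
    (mesoscaleSuperlinearityE_of (positionMesoscaleLD_of_densityLD hD) (stub_velocityLD stub_ballGaussianEstimate))

/-- **THE CRUX FROM THE LOG-LAPLACE BOUND AND THE FOUR EQUILIBRIUM / A-PRIORI INPUTS** (skeleton v15, appended by lead c7): the net reduction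
`stub_densityLD_of_ballTilt` (p140278) puts the whole statics side on `BallTiltLogLaplace` — the uniform quadratic log-Laplace bound for ball-average
linear statistics of the canonical inhomogeneous dilute hard-sphere gas. [cite: Yau1991, §2] -/
theorem nearConstantShortTimeHL_of_ballTilt4 : BallTiltLogLaplace → MomentumClosureTightness4 → EnergyClosureTightness4 → TrueLawCapsG → FourthMomentCapPreShock → NearConstantShortTimeHL :=
  fun hB => nearConstantShortTimeHL_of_densityLD4 (stub_densityLD_of_ballTilt hB)

end Summit.AtomisticToContinuum.HydrodynamicLimit.Theorems.NearConstantShortTimeHL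

end
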